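import Mathlib.Algebra.Category.ModuleCat.Ext.HasExt
import Mathlib.Algebra.Homology.DerivedCategory.Ext.Linear
import Mathlib.Algebra.Homology.DerivedCategory.Ext.ExactSequences
import Mathlib.Algebra.Homology.DerivedCategory.Ext.EnoughProjectives
import Mathlib.RingTheory.Ideal.Operations
import Mathlib.Algebra.BigOperators.Intervals
import HarnessLib

/-!
# The "staircase" annihilation lemma for the dual of a projective resolution

Topic: `Literature/AlgebraicGeometry/Resolution` (homological input of the annihilator theorems of
Roberts–Schenzel–Bruns–Herzog used for Macaulayfication, see `ParameterColonAnnihilator.lean`).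

Bruns–Herzog [BrunsHerzog1998, Thm. 8.1.2] (after P. Roberts and P. Schenzel [Schenzel1982,
Satz 2.3.1]) prove: for a finite complex `G` of finite free modules over a Noetherian local ring,
suitable products of annihilators of cohomology modules kill the (co)homology of `G` twisted by a
module; the printed proof runs two spectral sequences of a double complex. We isolate the purely
homological mechanism in an elementary, spectral-sequence-free form ("staircase"): the complex is
presented through its short exact pieces

`0 → B^q → Z^q → E^q → 0` (boundaries, cycles, cohomology) and `0 → Z^q → G^q → B^{q+1} → 0`,

with `G^q` projective and `B^q` projective (e.g. `0`) for `q > n`, and we show that for any module `Q` and ideals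
`𝔞 q` such that, for every `q ≥ 1`, EITHER `𝔞 q` annihilates `E^q` OR `Ext^{q-1}(E^q, Q) = 0`,
every element of `𝔞 1 ⋯ 𝔞 n` multiplies any morphism `z : G^1 → Q` vanishing on `B^1` into a
morphism factoring through `G^1 → B^2 → Z^2 → G^2` — i.e. it kills the class of `z` in
`H_1(Hom(G, Q))`. The proof is a descending induction on `q` through the classes in
`Ext^{q-2}(B^q, Q)`, using only the long exact `Ext` sequences of Mathlib
(`Ext.contravariant_sequence_exact₁`) and `Ext^{≥1}(P, -) = 0` for `P` projective.

## Main statements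

* `StaircaseData` — the data `(Z, G, B, E, i, p, ι, ρ)` with the two families of short exact
  sequences, `G q` projective.
* `StaircaseData.smul_ext_eq_zero_of_mem_prod` — `(∏_{t ≥ q} 𝔞 t) · Ext^{q-2}(B^q, Q) = 0` for
  `q ≥ 3` (the descending induction).
* `StaircaseData.exists_factor_of_mem_prod` — **the staircase lemma**: for `z : G 1 ⟶ Q` with
  `i 1 ≫ ι 1 ≫ z = 0` and `c ∈ ∏_{1 ≤ t ≤ n} 𝔞 t` there is `w : G 2 ⟶ Q` with
  `c • z = ρ 1 ≫ i 2 ≫ ι 2 ≫ w`.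

[cite: BrunsHerzog1998, Thm. 8.1.2 (mechanism of the proof); Schenzel1982, Satz 2.3.1]
-/

noncomputable section

open CategoryTheory CategoryTheory.Abelian CategoryTheory.Limits

universe u

namespace Literature.AlgebraicGeometry.Resolution

variable (R : Type u) [CommRing R]

/-- **Staircase data**: a cochain complex of projective `R`-modules `G^1 → G^2 → ⋯` presented
through its cycles `Z^q`, boundaries `B^q` and cohomology `E^q = Z^q/B^q`, i.e. through the short
exact sequences `0 → B^q →(i) Z^q →(p) E^q → 0` and `0 → Z^q →(ι) G^q →(ρ) B^{q+1} → 0`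
(the differential being `G^q →(ρ) B^{q+1} →(i) Z^{q+1} →(ι) G^{q+1}`). Only indices `q ≥ 1`
matter. [cite: BrunsHerzog1998, Thm. 8.1.2 (setting)] -/
structure StaircaseData where
  /-- cycles `Z^q` -/
  Z : ℕ → ModuleCat.{u} R
  /-- the projective terms `G^q` -/
  G : ℕ → ModuleCat.{u} R
  /-- boundaries `B^q` -/
  B : ℕ → ModuleCat.{u} R
  /-- cohomology `E^q` -/
  E : ℕ → ModuleCat.{u} R
  /-- `B^q ↪ Z^q` -/
  i : ∀ q, B q ⟶ Z q
  /-- `Z^q ↠ E^q` -/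
  p : ∀ q, Z q ⟶ E q
  /-- `Z^q ↪ G^q` -/
  ι : ∀ q, Z q ⟶ G q
  /-- `G^q ↠ B^{q+1}` -/
  ρ : ∀ q, G q ⟶ B (q + 1)
  i_p : ∀ q, i q ≫ p q = 0
  ι_ρ : ∀ q, ι q ≫ ρ q = 0
  shortExact₁ : ∀ q, (ShortComplex.mk (i q) (p q) (i_p q)).ShortExact
  shortExact₂ : ∀ q, (ShortComplex.mk (ι q) (ρ q) (ι_ρ q)).ShortExact
  projective : ∀ q, Projective (G q)

namespace StaircaseData

variable {R}
variable (X : StaircaseData R)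

/-- The short exact sequence `0 → B^q → Z^q → E^q → 0`. [cite: BrunsHerzog1998, Thm. 8.1.2 (setting)] -/
abbrev S₁ (q : ℕ) : ShortComplex (ModuleCat.{u} R) := ShortComplex.mk (X.i q) (X.p q) (X.i_p q)

/-- The short exact sequence `0 → Z^q → G^q → B^{q+1} → 0`. [cite: BrunsHerzog1998, Thm. 8.1.2 (setting)] -/
abbrev S₂ (q : ℕ) : ShortComplex (ModuleCat.{u} R) := ShortComplex.mk (X.ι q) (X.ρ q) (X.ι_ρ q)

/-- `G^q` is projective. [cite: BrunsHerzog1998, Thm. 8.1.2 (setting)] -/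
instance projective_G (q : ℕ) : Projective (X.G q) := X.projective q

/-- `Z^q ↠ E^q` is epi. [folklore] -/
instance epi_p (q : ℕ) : Epi (X.p q) := (X.shortExact₁ q).epi_g

/-- `G^q ↠ B^{q+1}` is epi. [folklore] -/
instance epi_ρ (q : ℕ) : Epi (X.ρ q) := (X.shortExact₂ q).epi_g

/-- `B^q ↪ Z^q` is mono. [folklore] -/
instance mono_i (q : ℕ) : Mono (X.i q) := (X.shortExact₁ q).mono_f

/-- `Z^q ↪ G^q` is mono. [folklore] -/
instance mono_ι (q : ℕ) : Mono (X.ι q) := (X.shortExact₂ q).mono_f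

/-! ## Generalities on the `R`-action on `Ext` -/

/-- If `a` kills the module `E` then `a` kills `Extⁿ(E, Y)`. [folklore] -/
theorem smul_ext_eq_zero_of_smul_id_eq_zero {E Y : ModuleCat.{u} R} {a : R}
    (ha : a • (𝟙 E) = 0) {n : ℕ} (x : Ext.{u} E Y n) : a • x = 0 := by
  have h : a • x = (Ext.mk₀ (a • 𝟙 E)).comp x (zero_add n) := by
    rw [Ext.mk₀_smul, Ext.smul_comp, Ext.mk₀_id_comp]
  rw [h, ha, Ext.mk₀_zero, Ext.zero_comp]

/-- `a • 𝟙 E = 0` in `ModuleCat` when `a` annihilates every element of `E`. [folklore] -/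
theorem smul_id_eq_zero_of_forall_smul_eq_zero {E : ModuleCat.{u} R} {a : R}
    (ha : ∀ e : E, a • e = 0) : a • (𝟙 E) = 0 := by
  ext e
  simp [ha e]

/-- `Ext` groups out of a zero object vanish. [folklore] -/
theorem ext_eq_zero_of_isZero {E Y : ModuleCat.{u} R} (hE : IsZero E) {n : ℕ}
    (x : Ext.{u} E Y n) : x = 0 := by
  rw [← Ext.mk₀_id_comp x, hE.eq_of_src (𝟙 E) 0, Ext.mk₀_zero, Ext.zero_comp]

/-! ## The descending induction -/

section

variable (Q : ModuleCat.{u} R) (𝔞 : ℕ → Ideal R) (n : ℕ)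

/-
The HYPOTHESIS of the staircase lemma (kept inline in every statement below): for every level
`q ≥ 1` (written `d + 1 = q`), either `𝔞 q` annihilates `E^q`, or `Ext^{q-1}(E^q, Q) = 0`:
`∀ q d : ℕ, 1 ≤ q → d + 1 = q → (∀ a ∈ 𝔞 q, ∀ e : X.E q, a • e = 0) ∨ (∀ x : Ext (X.E q) Q d, x = 0)`.
-/

variable {X Q 𝔞 n}

/-- From the hypothesis at level `q`: `𝔞 q` kills `Ext^{q-1}(E^q, Q)`. [folklore] -/
theorem smul_ext_E_eq_zero
    (h : ∀ q d : ℕ, 1 ≤ q → d + 1 = q →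
      (∀ a ∈ 𝔞 q, ∀ e : X.E q, a • e = 0) ∨ (∀ x : Ext.{u} (X.E q) Q d, x = 0))
    {q d : ℕ} (hq : 1 ≤ q) (hd : d + 1 = q) {a : R}
    (ha : a ∈ 𝔞 q) (x : Ext.{u} (X.E q) Q d) : a • x = 0 := by
  rcases h q d hq hd with h1 | h2
  · exact smul_ext_eq_zero_of_smul_id_eq_zero (smul_id_eq_zero_of_forall_smul_eq_zero (h1 a ha)) x
  · rw [h2 x, smul_zero]

/-- **Descending induction** (levels `q ≥ 3`): if `B^t` is projective for `t > n`, then every element of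
`∏_{t ∈ [k+3, n]} 𝔞 t` kills `Ext^{k+1}(B^{k+3}, Q)`. At level `t` one pushes a class
`o ∈ Ext^{t-2}(B^t, Q)` to `Ext^{t-1}(E^t, Q)` (killed by `𝔞 t`), pulls `𝔞 t • o` back to
`Ext^{t-2}(Z^t, Q)`, and pushes that to `Ext^{t-1}(B^{t+1}, Q)`, killed by induction; the
pull-back to `Ext^{t-2}(G^t, Q) = 0` (projective, `t - 2 ≥ 1`) finishes.
[cite: BrunsHerzog1998, Thm. 8.1.2 (proof)] -/
theorem smul_ext_eq_zero_of_mem_prod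
    (h : ∀ q d : ℕ, 1 ≤ q → d + 1 = q →
      (∀ a ∈ 𝔞 q, ∀ e : X.E q, a • e = 0) ∨ (∀ x : Ext.{u} (X.E q) Q d, x = 0))
    (hB : ∀ q, n < q → Projective (X.B q)) :
    ∀ (m k : ℕ), n + 1 ≤ k + 3 + m →
      ∀ c ∈ ∏ t ∈ Finset.Ico (k + 3) (n + 1), 𝔞 t,
        ∀ o : Ext.{u} (X.B (k + 3)) Q (k + 1), c • o = 0 := by
  intro m
  induction m with
  | zero =>
    intro k hk c _ o
    haveI := hB (k + 3) (by omega)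
    rw [Ext.eq_zero_of_projective o, smul_zero]
  | succ m ih =>
    intro k hk c hc o
    by_cases hk' : n + 1 ≤ k + 3 + m
    · exact ih k hk' c hc o
    · -- here `k + 3 ≤ n`: peel off `𝔞 (k+3)`
      have hlt : k + 3 < n + 1 := by omega
      rw [Finset.prod_eq_prod_Ico_succ_bot hlt] at hc
      refine Submodule.mul_induction_on hc (fun a ha b hb => ?_) (fun x y hx hy => ?_)
      · -- push `o` to `Ext^{k+2}(E^{k+3}, Q)`; `a` kills it, so `a • o` comes from `Z^{k+3}`
        have hδ : (X.shortExact₁ (k + 3)).extClass.comp (a • o) (by omega : 1 + (k + 1) = k + 2) = 0 := by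
          rw [Ext.comp_smul]
          exact smul_ext_E_eq_zero h (by omega) rfl ha _
        obtain ⟨x₂, hx₂⟩ :=
          Ext.contravariant_sequence_exact₁ (X.shortExact₁ (k + 3)) Q (a • o) (by omega) hδ
        -- push `x₂` to `Ext^{k+2}(B^{k+4}, Q)`: killed by `b` (induction), so `b • x₂` comes from
        -- `Ext^{k+1}(G^{k+3}, Q) = 0`
        have hb' : ∀ o' : Ext.{u} (X.B (k + 1 + 3)) Q (k + 1 + 1), b • o' = 0 :=
          ih (k + 1) (by omega) b (by simpa [show k + 1 + 3 = k + 3 + 1 by omega] using hb)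
        have hδ' : (X.shortExact₂ (k + 3)).extClass.comp (b • x₂)
            (by omega : 1 + (k + 1) = k + 2) = 0 := by
          rw [Ext.comp_smul]
          exact hb' _
        obtain ⟨y, hy⟩ :=
          Ext.contravariant_sequence_exact₁ (X.shortExact₂ (k + 3)) Q (b • x₂) (by omega) hδ'
        have hy0 : y = 0 := Ext.eq_zero_of_projective y
        have hbx : b • x₂ = 0 := by rw [← hy, hy0, Ext.comp_zero]
        calc (a * b) • o = b • (a • o) := by rw [mul_comm, mul_smul]
          _ = b • ((Ext.mk₀ (X.S₁ (k + 3)).f).comp x₂ (zero_add _)) := by rw [hx₂]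
          _ = 0 := by rw [← Ext.comp_smul, hbx, Ext.comp_zero]
      · rw [add_smul, hx, hy, add_zero]

/-- **Level 2 of the staircase**: for `u : B^2 ⟶ Q` and `c ∈ 𝔞 2 · ∏_{t ∈ [3, n]} 𝔞 t`, the
morphism `c • u` extends to `G^2` along `B^2 → Z^2 → G^2`. [cite: BrunsHerzog1998, Thm. 8.1.2 (proof)] -/
theorem exists_factor_level_two
    (h : ∀ q d : ℕ, 1 ≤ q → d + 1 = q →
      (∀ a ∈ 𝔞 q, ∀ e : X.E q, a • e = 0) ∨ (∀ x : Ext.{u} (X.E q) Q d, x = 0))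
    (hB : ∀ q, n < q → Projective (X.B q)) (u : X.B 2 ⟶ Q) :
    ∀ c ∈ 𝔞 2 * ∏ t ∈ Finset.Ico 3 (n + 1), 𝔞 t,
      ∃ w : X.G 2 ⟶ Q, c • u = X.i 2 ≫ X.ι 2 ≫ w := by
  intro c hc
  refine Submodule.mul_induction_on hc (fun a ha b hb => ?_) (fun x y hx hy => ?_)
  · -- `δ(u) ∈ Ext¹(E², Q)` is killed by `a`, so `a • u` extends to `v : Z² ⟶ Q`
    have hδ : (X.shortExact₁ 2).extClass.comp (a • Ext.mk₀ u) (by omega : 1 + 0 = 1) = 0 := by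
      rw [Ext.comp_smul]
      exact smul_ext_E_eq_zero h (by omega) rfl ha _
    obtain ⟨x₂, hx₂⟩ := Ext.contravariant_sequence_exact₁ (X.shortExact₁ 2) Q (a • Ext.mk₀ u) (by omega) hδ
    obtain ⟨v, rfl⟩ := (Ext.mk₀_bijective _ _).2 x₂
    have hv : X.i 2 ≫ v = a • u := by
      apply (Ext.mk₀_bijective _ _).1
      rw [← Ext.mk₀_comp_mk₀, Ext.mk₀_smul]
      exact hx₂
    -- `δ'(v) ∈ Ext¹(B³, Q)` is killed by `b` (descending induction), so `b • v` extends to `G²`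
    have hb' : b • (X.shortExact₂ 2).extClass.comp (Ext.mk₀ v) (by omega : 1 + 0 = 1) = 0 :=
      X.smul_ext_eq_zero_of_mem_prod h hB n 0 (by omega) b hb _
    have hδ' : (X.shortExact₂ 2).extClass.comp (b • Ext.mk₀ v) (by omega : 1 + 0 = 1) = 0 := by
      rw [Ext.comp_smul, hb']
    obtain ⟨y, hy⟩ := Ext.contravariant_sequence_exact₁ (X.shortExact₂ 2) Q (b • Ext.mk₀ v) (by omega) hδ'
    obtain ⟨w, rfl⟩ := (Ext.mk₀_bijective _ _).2 y
    have hw : X.ι 2 ≫ w = b • v := by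
      apply (Ext.mk₀_bijective _ _).1
      rw [← Ext.mk₀_comp_mk₀, Ext.mk₀_smul]
      exact hy
    refine ⟨w, ?_⟩
    calc (a * b) • u = b • (a • u) := by rw [mul_comm, mul_smul]
      _ = b • (X.i 2 ≫ v) := by rw [hv]
      _ = X.i 2 ≫ (b • v) := by rw [Linear.comp_smul]
      _ = X.i 2 ≫ X.ι 2 ≫ w := by rw [hw]
  · obtain ⟨w₁, hw₁⟩ := hx
    obtain ⟨w₂, hw₂⟩ := hy
    exact ⟨w₁ + w₂, by rw [add_smul, hw₁, hw₂, Preadditive.comp_add, Preadditive.comp_add]⟩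

/-- **The staircase lemma** (level 1): let `z : G^1 ⟶ Q` vanish on `B^1` (i.e. `z` is a `1`-cycle of
`Hom(G, Q)`), let `B^q` be projective for `q > n` (`n ≥ 2`), and assume that for every `q ≥ 1` either `𝔞 q`
annihilates `E^q` or `Ext^{q-1}(E^q, Q) = 0`. Then for every `c ∈ 𝔞 1 ⋯ 𝔞 n` the morphism
`c • z` factors through the differential `G^1 → B^2 → Z^2 → G^2` (i.e. `c` kills the class of
`z` in `H_1(Hom(G, Q))`). This is the homological core of [BrunsHerzog1998, Thm. 8.1.2]
(there: `𝔞 q = Ann H^q_𝔪`, via two spectral sequences); here proved by the elementary descending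
induction `smul_ext_eq_zero_of_mem_prod`. [cite: BrunsHerzog1998, Thm. 8.1.2] -/
theorem exists_factor_of_mem_prod
    (h : ∀ q d : ℕ, 1 ≤ q → d + 1 = q →
      (∀ a ∈ 𝔞 q, ∀ e : X.E q, a • e = 0) ∨ (∀ x : Ext.{u} (X.E q) Q d, x = 0))
    (hn : 2 ≤ n) (hB : ∀ q, n < q → Projective (X.B q)) (z : X.G 1 ⟶ Q)
    (hz : X.i 1 ≫ X.ι 1 ≫ z = 0) :
    ∀ c ∈ ∏ t ∈ Finset.Ico 1 (n + 1), 𝔞 t,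
      ∃ w : X.G 2 ⟶ Q, c • z = X.ρ 1 ≫ X.i 2 ≫ X.ι 2 ≫ w := by
  intro c hc
  rw [Finset.prod_eq_prod_Ico_succ_bot (show 1 < n + 1 by omega),
    Finset.prod_eq_prod_Ico_succ_bot (show 2 < n + 1 by omega)] at hc
  refine Submodule.mul_induction_on hc (fun a ha c' hc' => ?_) (fun x y hx hy => ?_)
  · -- `ι 1 ≫ z` vanishes on `B¹`, hence factors through `E¹`; `a` kills that factor
    have hk : (X.S₁ 1).f ≫ (X.ι 1 ≫ z) = 0 := hz
    set ē : X.E 1 ⟶ Q := (X.shortExact₁ 1).exact.desc (X.ι 1 ≫ z) hk with hē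
    have hpē : X.p 1 ≫ ē = X.ι 1 ≫ z := (X.shortExact₁ 1).exact.g_desc _ _
    have haē : a • ē = 0 := by
      rcases h 1 0 le_rfl rfl with h1 | h2
      · rw [← Category.id_comp ē, ← Linear.smul_comp,
          smul_id_eq_zero_of_forall_smul_eq_zero (h1 a ha), zero_comp]
      · have := h2 (Ext.mk₀ (a • ē))
        rwa [Ext.mk₀_eq_zero_iff] at this
    have hιz : (X.S₂ 1).f ≫ (a • z) = 0 := by
      change X.ι 1 ≫ (a • z) = 0
      rw [Linear.comp_smul, ← hpē, ← Linear.comp_smul, haē, comp_zero]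
    set u : X.B 2 ⟶ Q := (X.shortExact₂ 1).exact.desc (a • z) hιz with hu
    have hρu : X.ρ 1 ≫ u = a • z := (X.shortExact₂ 1).exact.g_desc _ _
    obtain ⟨w, hw⟩ := X.exists_factor_level_two h hB u c' hc'
    refine ⟨w, ?_⟩
    calc (a * c') • z = c' • (a • z) := by rw [mul_comm, mul_smul]
      _ = c' • (X.ρ 1 ≫ u) := by rw [hρu]
      _ = X.ρ 1 ≫ (c' • u) := by rw [Linear.comp_smul]
      _ = X.ρ 1 ≫ X.i 2 ≫ X.ι 2 ≫ w := by rw [hw]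
  · obtain ⟨w₁, hw₁⟩ := hx
    obtain ⟨w₂, hw₂⟩ := hy
    exact ⟨w₁ + w₂, by
      rw [add_smul, hw₁, hw₂, Preadditive.comp_add, Preadditive.comp_add, Preadditive.comp_add]⟩

end

end StaircaseData

end Literature.AlgebraicGeometry.Resolution

end
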